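import Literature.AnabelianGeometry.EtaleTheta.Discharge.Sec5Thm57FinalKnitReduced
import Literature.AnabelianGeometry.EtaleTheta.Discharge.Sec5Thm57GenuineBindersA

/-!
# [EtTh] §5, Theorem 5.7 at the genuine connected tower — FINAL KNIT v2: (A) reduced to «Φ non-dilating» (pp. 329–331 / PDF pp. 103–105)

Mochizuki, *The étale theta function …*, Publ. RIMS **45** (2009) [cite: MochizukiEtTh2009, Thm 5.7 p.330 (PDF p.104); Lem 5.8 p.331
(PDF p.105); Rmk 4.3.2 p.318–319 (PDF pp.92–93); Def 3.6 (ii)(iii)(iv) p.303–304 (PDF pp.77–78)].  Seat abc-iut-L2-d4 (gen 5; node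
`EtTh:Thm5.7`, row R219/R381, FILE 5).  PROOF-ONLY (0 defs): the COMPOSITION of abc-iut-w5-d123's
`thetaRootPreservedAll_ofConnectedTemperoidYddFamily_ofAnchored_genuine_of_constantsDictionary` (p447915: the (A)-binders `hN` GONE,
`hinj` ⟸ {`hc₀`, `ht`}, `hfac₁` ⟸ {`hP34`, `ecn`, `hYdd`}, `hgc₁` ⟸ {`ConstantsDictionary`, `hY₁`} — morphism universe `0`) with the
discharges of `Sec5Thm57FinalKnitReduced.lean` (p447315: `hfam` ⟸ abc-iut-w5-d245's FILE 2 p445776 over abc-iut-f-121's rebase; seeds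
⟸ `hcharN`/`hdivA` via abc-iut-w5-d245's p446085 + Sec5SeedBaseIsoOfCharacteristic; `hpull₂`/`hD`/`hf` ⟸ `hF`/`hαover`/`hii` via
abc-iut-f-121's Sec4RootRebaseModel; the pow/sat clauses of `hroot` ⟸ p443529/p438735).
RESULT `thetaRootPreservedAll_ofConnectedTemperoidYddFamily_final_v2`: Thm. 5.7 (root level, all identifications) at every level of the
genuine tower MODULO: (A) `hnd` ALONE (print's standing hypothesis "`Φ` non-dilating", Thm. 3.7 (ii) / Cor. 3.8) + the junction data of
record {`hc₀`, `ht`; `ConstantsDictionary` `hD₁`, `hY₁`; `cnst`, `G`, `ecn`, `hP34`, `hYdd`}; `hF`, `hαover`; (anchor) `hcharN`, `hdivA`,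
`hP24`; (§4) `h44`, `ψ`, `hpull`, `hii`, `h3`, `h4b`, `h8`, `h15a`, `h15`, `D N`, `hArises`, `hebs`, `hroot₁N`, `hivP'`; (C) `hc`.
HONEST FRAMING: kernel-checked composition of landed theorems for data so parametrised (no instance of the class `TemperedFrobenioid
T₀ (ConnectedPart (BTemp X.Pi)) VD` for an actual curve is constructed here); nothing asserts any result of [EtTh] unconditionally;
typed ≠ discharged — PROVED modulo the displayed binders; no side taken on anything downstream ([IUTchIII] Cor. 3.12 in particular). -/

noncomputable section

namespace Literature.AnabelianGeometry.EtaleTheta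

open CategoryTheory Opposite Literature.AlgebraicGeometry.Frobenioids Literature.AnabelianGeometry.SemiGraphs
  Literature.AnabelianGeometry.SemiGraphs.GaloisObjects

universe v₀ u₁ v₁

namespace ThetaFrobenioidTower

section Dictionary

variable {K : Type} [Field K] {X : SemiGraphs.TemperedArithmeticGroup.{0} K} {D₀ : Type} [Category.{v₀} D₀]
  {V : FrdIMonoidStub.{0}} {T₀ : RealifiedDivisorMonoids (D₀ := D₀) V}
  {VD : FrdICatStub.{1, 0, 0} (ConnectedPart (BTemp X.Pi))}
  {tf : TemperedFrobenioid T₀ (ConnectedPart (BTemp X.Pi)) VD} {hZ : tf.monoidType = MonoidType.Z}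
  {hP : ∀ A : (ConnectedPart (BTemp X.Pi))ᵒᵖ, IsPerfect (tf.Φ.carrier A)}
  {NH : Subgroup (Field.absoluteGaloisGroup K) → tf.category → ℕ+ → Prop}
  {E : Set ℕ+} (𝒯 : ThetaEnvTower.{0} E) (ιX : 𝒯.PiX ≃ₜ* X.Pi)
  {pullFrac : ∀ {A A' : (BiKummerSetting.mkOfConnectedTemperoidYddTower X tf hZ hP NH 𝒯 ιX).C} (_ : A' ⟶ A),
    (BiKummerSetting.mkOfConnectedTemperoidYddTower X tf hZ hP NH 𝒯 ιX).biratUnits A →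
      (BiKummerSetting.mkOfConnectedTemperoidYddTower X tf hZ hP NH 𝒯 ιX).biratUnits A'}
  {lv : ℕ+}
  {θ : (BiKummerSetting.mkOfConnectedTemperoidYddTower X tf hZ hP NH 𝒯 ιX).biratUnits
    (BiKummerSetting.mkOfConnectedTemperoidYddTower X tf hZ hP NH 𝒯 ιX).Aodot}
  {Bl : (BiKummerSetting.mkOfConnectedTemperoidYddTower X tf hZ hP NH 𝒯 ιX).C}
  {Pl : (BiKummerSetting.mkOfConnectedTemperoidYddTower X tf hZ hP NH 𝒯 ιX).FractionPair θ Bl}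
  {Rl : (BiKummerSetting.mkOfConnectedTemperoidYddTower X tf hZ hP NH 𝒯 ιX).NthRoot θ Pl lv pullFrac}
  (h : ModelFrobenioid.Hypotheses tf.divisorMonoid tf.ratFnFunctor)
  (Q : FrobenioidTheta.ThetaSubquotientStub.{0} (ConnectedPart (BTemp X.Pi))) (odd_l : Odd (lv : ℕ))
  (R : ∀ N : ℕ+, (BiKummerSetting.mkOfConnectedTemperoidYddTower X tf hZ hP NH 𝒯 ιX).NthRoot Rl.root Rl.pair N pullFrac)
  (K' : Type) [Field K'] {X₀ : ConnectedPart (BTemp X.Pi)}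
  (hX₀ : ∀ Y : ConnectedPart (BTemp X.Pi), Subsingleton (Y ⟶ X₀)) (t : ∀ N : ℕ+, (R N).BN.base ⟶ X₀)
  (c₀ : K'ˣ →* (tf.ratFnFunctor.obj (op X₀))ˣ)
  (hc₀ : Function.Injective c₀) (ht : ∀ N : ℕ+, Function.Injective (tf.ratFnFunctor.map (t N).op).hom)
  (hinvc : ∀ (N : ℕ+) (g : Aut (R N).AN.base),
    pull tf.divisorMonoid g.hom (ModelFrobenioid.div (R N).pair.num) = ModelFrobenioid.div (R N).pair.num)
  (hinvp : ∀ (N : ℕ+) (y : 𝒯.PiX), y ∈ 𝒯.PiYdd →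
    pull tf.divisorMonoid ((BiKummerSetting.mkOfConnectedTemperoidYddTower X tf hZ hP NH 𝒯 ιX).galoisSurj (R N).AN.base
      (R N).αData.isGalois (ιX y)).hom (ModelFrobenioid.div (R N).pair.den) = ModelFrobenioid.div (R N).pair.den)
  (α : ∀ {N N' : ℕ+}, (N : ℕ) ∣ N' → ((R N').AN ⟶ (R N).AN))
  (β : ∀ {N N' : ℕ+}, (N : ℕ) ∣ N' → ((R N').BN ⟶ (R N).BN))
  (comm_sCap : ∀ {N N' : ℕ+} (hd : (N : ℕ) ∣ N'), (R N').pair.num ≫ β hd = α hd ≫ (R N).pair.num)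
  (comm_sCup : ∀ {N N' : ℕ+} (hd : (N : ℕ) ∣ N'), (R N').pair.den ≫ β hd = α hd ≫ (R N).pair.den)
  (isIsometry_α : ∀ {N N' : ℕ+} (hd : (N : ℕ) ∣ N'),
    ((BiKummerSetting.mkOfConnectedTemperoidYddTower X tf hZ hP NH 𝒯 ιX).sec5Stub h).pre.IsIsometry (α hd))
  (degFr_α : ∀ {N N' : ℕ+} (hd : (N : ℕ) ∣ N'),
    (((BiKummerSetting.mkOfConnectedTemperoidYddTower X tf hZ hP NH 𝒯 ιX).sec5Stub h).pre.degFr (α hd) : ℕ) * N = N')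
  (isIsometry_β : ∀ {N N' : ℕ+} (hd : (N : ℕ) ∣ N'),
    ((BiKummerSetting.mkOfConnectedTemperoidYddTower X tf hZ hP NH 𝒯 ιX).sec5Stub h).pre.IsIsometry (β hd))
  (degFr_β : ∀ {N N' : ℕ+} (hd : (N : ℕ) ∣ N'),
    (((BiKummerSetting.mkOfConnectedTemperoidYddTower X tf hZ hP NH 𝒯 ιX).sec5Stub h).pre.degFr (β hd) : ℕ) * N = N')
  (baseFrob_α : ∀ {N N' : ℕ+} (hd : (N : ℕ) ∣ N'),
    (BiKummerSetting.mkOfConnectedTemperoidYddTower X tf hZ hP NH 𝒯 ιX).IsOfBaseFrobeniusType (α hd))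
  -- the §1 Setting against which the constants of `B_1` are read (abc-iut-L2-t8's model `Cu.thetaEnvData μ₁ hC hS`)
  {p : ℕ} [Fact p.Prime] {DS : ThetaSetting p} {ES : DS.EtaleThetaData} {l' : ℕ} (Cu : ES.DoubleUnderline l')
  (hC : DS.Compat) (hS : DS.Sec2Hyps)
  (h44 : BiKummerSetting.Thm44Hyp (BiKummerSetting.mkOfConnectedTemperoidYddTower X tf hZ hP NH 𝒯 ιX)
    (BiKummerSetting.mkOfConnectedTemperoidYddTower X tf hZ hP NH 𝒯 ιX))
  (ψ : ∀ A : (BiKummerSetting.mkOfConnectedTemperoidYddTower X tf hZ hP NH 𝒯 ιX).C,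
    (BiKummerSetting.mkOfConnectedTemperoidYddTower X tf hZ hP NH 𝒯 ιX).biratUnits A ≃*
      (BiKummerSetting.mkOfConnectedTemperoidYddTower X tf hZ hP NH 𝒯 ιX).biratUnits (h44.Ψ.functor.obj A))
  (hpull : ∀ {A A' : (BiKummerSetting.mkOfConnectedTemperoidYddTower X tf hZ hP NH 𝒯 ιX).C} (φ : A' ⟶ A)
    (f : (BiKummerSetting.mkOfConnectedTemperoidYddTower X tf hZ hP NH 𝒯 ιX).biratUnits A),
      ψ A' (pullFrac φ f) = pullFrac (h44.Ψ.functor.map φ) (ψ A f))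
  (hii : BiKummerSetting.Thm44_ii h44 ψ) (h3 : h44.PreservesFrobeniusStructure) (h4b : h44.PreservesBaseFrobeniusTypeData)
  (h8 : h44.PreservesAmple) (h15a : h44.PreservesFixedByHA ψ) (h15 : h44.PreservesSaturated ψ)
  -- (B1)/(B1′): the Def. 4.1 (iv) datum of each transition `α_{1,N}` and its pull-back compatibility
  (D : ∀ N : ℕ+, (BiKummerSetting.mkOfConnectedTemperoidYddTower X tf hZ hP NH 𝒯 ιX).BaseFrobeniusTypeData (α (one_dvd_level N)))

include hX₀ h hc₀ ht comm_sCap comm_sCup isIsometry_α degFr_α isIsometry_β degFr_β hpull hii h3 h4b h8 h15a h15 in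
/-- **[EtTh] Theorem 5.7 at the genuine connected tower — FINAL KNIT v2** (residual (A) = «`Φ` non-dilating» + the junction data of
record; see the module docstring).  [cite: MochizukiEtTh2009, Thm 5.7 p.329–330 (PDF pp.103–104); Lem 5.8 p.331 (PDF p.105); Rmk 4.3.2 p.318–319 (PDF pp.92–93)] -/
theorem thetaRootPreservedAll_ofConnectedTemperoidYddFamily_final_v2
    (T : ThetaFrobenioidTower.{0} (BiKummerSetting.mkOfConnectedTemperoidYddTower X tf hZ hP NH 𝒯 ιX).C
      (ConnectedPart (BTemp X.Pi)))
    (hT : T = ofConnectedTemperoidFamily h Q odd_l R ιX K' (fun N => (Units.map (tf.ratFnFunctor.map (t N).op).hom).comp c₀)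
      (fun N => tf.unitsMap_comp_injective (t N) hc₀ (ht N)) hinvc hinvp α β comm_sCap comm_sCup isIsometry_α degFr_α
      isIsometry_β degFr_β baseFrob_α)
    (hnd : IsNonDilatingOn tf.divisorMonoid)
    -- (A) `hgc₁` RE-KEYED (abc-iut-w5-d123 p447915): the ONE `ConstantsDictionary` junction binder at the first root + `hY₁`
    {μ₁ : DS.CyclotomeMod l' (T.atLevel 1).N} {ι₁ : (T.atLevel 1).PiX ≃ₜ* (Cu.thetaEnvData μ₁ hC hS).PiX}
    {m₁ : (T.atLevel 1).muTorsion (T.atLevel 1).BN (T.atLevel 1).N ≃* (Cu.thetaEnvData μ₁ hC hS).mu}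
    (act₁ : (T.atLevel 1).BiratAutAction) {Cst₁ : Subgroup ((T.atLevel 1).biratUnits (T.atLevel 1).BN)}
    {ν₁ : Cst₁ →* (PadicAlgCl p)ˣ}
    (hD₁ : ThetaFrobenioid.BiratAutAction.ConstantsDictionary act₁ Cu μ₁ hC hS ι₁ m₁ Cst₁ ν₁)
    (hY₁ : (T.atLevel 1).IdentifiesPiY (Cu.thetaEnvData μ₁ hC hS) ι₁.toMulEquiv)
    -- (A) `hfac₁` RE-KEYED (abc-iut-w5-d123 p447915): Prop. 3.4 (ii), the identification `D → D₀ → D^cnst ≅ aug_* ⋙ G`, and `hYdd`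
    {Dcnst : Type u₁} [Category.{v₁} Dcnst] (cnst : D₀ ⥤ Dcnst) (G : ConnectedPart (BTemp (Field.absoluteGaloisGroup K)) ⥤ Dcnst)
    (ecn : tf.base ⋙ cnst ≅ QuasiTemperoid.pushforward X.aug.toMonoidHom X.aug_surjective X.augIsOpenMap_holds ⋙ G)
    (hP34 : RealifiedDivisorMonoids.Prop34Cnst T₀ cnst)
    (hYdd : ∀ y : 𝒯.PiX, ∃ k ∈ 𝒯.PiYdd, X.aug (ιX k) = X.aug (ιX y))
    -- the rendering law of `pullFrac` (the model's `((·)^birat)^*`), the transitions over the base pair, and the Prop. 2.4-class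
    -- clause at the chosen first root ("`S₂^bs` characteristic", p.329): these DISCHARGE `hpull₂`, `hD`, `hf`, `hΨFT`, `hbs` of `…_final`
    (hF : ∀ {B B' : (BiKummerSetting.mkOfConnectedTemperoidYddTower X tf hZ hP NH 𝒯 ιX).C} (φ : B' ⟶ B)
      (y : (BiKummerSetting.mkOfConnectedTemperoidYddTower X tf hZ hP NH 𝒯 ιX).biratUnits B), pullFrac φ y = tf.pullFracModel φ y)
    (hαover : ∀ N : ℕ+, α (one_dvd_level N) ≫ (R 1).α = (R N).α)
    (hcharN : IsTopCharacteristic X.Pi (galoisSurjOf X.isTempered (R 1).AN.base.obj (R 1).αData.isGalois).ker)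
    (hdivA : ∀ αA : h44.Ψ.functor.obj (T.AN 1) ≅ T.AN 1, ∃ ε : Aut (T.AN 1),
      T.pre.div (αA.inv ≫ h44.Ψ.functor.map (T.sCap 1)) = T.pre.div (ε.hom ≫ T.sCap 1) ∧
      T.pre.div (αA.inv ≫ h44.Ψ.functor.map (T.sCup 1)) = T.pre.div (ε.hom ≫ T.sCup 1))
    (hP24 : ∀ γ : 𝒯.PiX ≃ₜ* 𝒯.PiX, 𝒯.PiYdd.map γ.toMulEquiv.toMonoidHom = 𝒯.PiYdd)
    -- per anchor and level: clause (e) pointwise at the anchor, and the base isomorphism of `Ψ` at `A_N` over `α_{1,N}`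
    (hArises : ∀ (α₁ : h44.Ψ.functor.obj (R 1).AN ≅ (R 1).AN) (N : ℕ+),
      (BiKummerSetting.mkOfConnectedTemperoidYddTower X tf hZ hP NH 𝒯 ιX).ArisesFromBaseFrobeniusPair
        ((D N).G.map (h44.Ψ.functor.mapAut (R N).AN)) (h44.Ψ.functor.map (D N).α₂) (h44.Ψ.functor.map (D N).α₁ ≫ α₁.hom))
    (hebs : ∀ (α₁ : h44.Ψ.functor.obj (R 1).AN ≅ (R 1).AN) (N : ℕ+),
      ∃ ebs : (BiKummerSetting.mkOfConnectedTemperoidYddTower X tf hZ hP NH 𝒯 ιX).base.obj (R N).AN ≅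
          (BiKummerSetting.mkOfConnectedTemperoidYddTower X tf hZ hP NH 𝒯 ιX).base.obj (h44.Ψ.functor.obj (R N).AN),
        (BiKummerSetting.mkOfConnectedTemperoidYddTower X tf hZ hP NH 𝒯 ιX).base.map (α (one_dvd_level N)) =
          ebs.hom ≫ (BiKummerSetting.mkOfConnectedTemperoidYddTower X tf hZ hP NH 𝒯 ιX).base.map
            (h44.Ψ.functor.map (α (one_dvd_level N)) ≫ α₁.hom))
    -- per unit `u₁` and level: `hroot₁N` — an `N`-th root of the level-1 discrepancy unit on `B_N` over `β_{1,N}` (Lem. 5.8 /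
    -- Def. 4.1 (iii)), with the `H_{A_N}`-fixedness of the pulled-back twisted function (abc-iut-f-123's reduction p443193)
    (hroot₁N : ∀ (u₁ : Aut (R 1).BN) (hu₁ : u₁ ∈ (BiKummerSetting.mkOfConnectedTemperoidYddTower X tf hZ hP NH 𝒯 ιX).units (R 1).BN)
      (N : ℕ+), ∃ (ut : Aut (R N).BN) (_ : ut ∈ (BiKummerSetting.mkOfConnectedTemperoidYddTower X tf hZ hP NH 𝒯 ιX).units (R N).BN),
        ut.hom ≫ β (one_dvd_level N) = β (one_dvd_level N) ≫ u₁.hom ∧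
        (BiKummerSetting.mkOfConnectedTemperoidYddTower X tf hZ hP NH 𝒯 ιX).IsFixedByHA (R N).AN (R N).isSaturated.isAmple.isGalois
          (pullFrac (D N).α₁
            ((BiKummerSetting.mkOfConnectedTemperoidYddTower X tf hZ hP NH 𝒯 ιX).fracOf (R 1).pair.num ((R 1).pair.den ≫ u₁.hom)
              (R 1).pair.isPreStep_num
              ((BiKummerSetting.mkOfConnectedTemperoidYddTower X tf hZ hP NH 𝒯 ιX).isPreStep_comp_aut (R 1).pair.isPreStep_den u₁)
              ((BiKummerSetting.mkOfConnectedTemperoidYddTower X tf hZ hP NH 𝒯 ιX).baseEquivalent_comp_unit (R 1).pair.base_eq hu₁))))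
    -- Prop. 4.2 (iv) at the `u₁`-twisted level-1 pair
    (hivP' : ∀ (u₁ : Aut (R 1).BN) (hu₁ : u₁ ∈ (BiKummerSetting.mkOfConnectedTemperoidYddTower X tf hZ hP NH 𝒯 ιX).units (R 1).BN)
      (N : ℕ+)
      (R' R'' : (BiKummerSetting.mkOfConnectedTemperoidYddTower X tf hZ hP NH 𝒯 ιX).NthRoot
        ((BiKummerSetting.mkOfConnectedTemperoidYddTower X tf hZ hP NH 𝒯 ιX).fracOf (R 1).pair.num ((R 1).pair.den ≫ u₁.hom)
          (R 1).pair.isPreStep_num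
          ((BiKummerSetting.mkOfConnectedTemperoidYddTower X tf hZ hP NH 𝒯 ιX).isPreStep_comp_aut (R 1).pair.isPreStep_den u₁)
          ((BiKummerSetting.mkOfConnectedTemperoidYddTower X tf hZ hP NH 𝒯 ιX).baseEquivalent_comp_unit (R 1).pair.base_eq hu₁))
        ((R 1).pair.twistUnit u₁ hu₁ rfl
          (BiKummerSetting.disjointSupports_twistUnit h.isDivisorial (R 1).pair u₁)) N pullFrac)
      (ebs : (BiKummerSetting.mkOfConnectedTemperoidYddTower X tf hZ hP NH 𝒯 ιX).base.obj R'.AN ≅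
        (BiKummerSetting.mkOfConnectedTemperoidYddTower X tf hZ hP NH 𝒯 ιX).base.obj R''.AN),
      (BiKummerSetting.mkOfConnectedTemperoidYddTower X tf hZ hP NH 𝒯 ιX).base.map R'.α =
        ebs.hom ≫ (BiKummerSetting.mkOfConnectedTemperoidYddTower X tf hZ hP NH 𝒯 ιX).base.map R''.α →
        ∃ (v : (BiKummerSetting.mkOfConnectedTemperoidYddTower X tf hZ hP NH 𝒯 ιX).mu R'.BN N) (ζA : R'.AN ≅ R''.AN)
          (ζB : R'.BN ≅ R''.BN),
          ζA.hom ≫ R''.pair.num = R'.pair.num ≫ ζB.hom ∧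
          ζA.hom ≫ R''.pair.den = (R'.pair.den ≫ (v : Aut R'.BN).hom) ≫ ζB.hom ∧
          ζA.hom ≫ R''.α = R'.α ∧ ζB.hom ≫ R''.β = R'.β ∧
          (BiKummerSetting.mkOfConnectedTemperoidYddTower X tf hZ hP NH 𝒯 ιX).base.mapIso ζA = ebs)
    -- (C): the level-1 discrepancy constant of every normalised transport is a `2l`-th root of unity
    (hc : ∀ (α₁ : h44.Ψ.functor.obj (T.AN 1) ≅ T.AN 1) (β₁ : h44.Ψ.functor.obj (T.BN 1) ≅ T.BN 1) (u₁ : Aut (T.BN 1))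
      (hu₁ : u₁ ∈ (T.atLevel 1).units (T.BN 1)),
      α₁.inv ≫ h44.Ψ.functor.map (T.sCap 1) ≫ β₁.hom = T.sCap 1 →
      α₁.inv ≫ h44.Ψ.functor.map (T.sCup 1) ≫ β₁.hom = T.sCup 1 ≫ u₁.hom →
        ∀ c : T.Kˣ, (T.atLevel 1).unitsToBirat (T.BN 1) ⟨u₁, hu₁⟩ = T.constEmb 1 c → c ^ (2 * T.l) = 1) :
    T.ThetaRootPreservedAll h44.Ψ := by
  -- `deg_Fr(α_{1,N}) = N = deg_Fr(β_{1,N})` from the tower's degree laws at `(1, N)`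
  have hdeg : ∀ {d N : ℕ+}, (d : ℕ) * ((1 : ℕ+) : ℕ) = N → d = N := fun hd => by
    rw [PNat.one_coe, mul_one] at hd
    exact PNat.coe_inj.mp hd
  have hD : ∀ N : ℕ+, pullFrac (D N).α₁ (R 1).root = pullFrac (R N).αData.α₁ Rl.root := fun N =>
    BiKummerSetting.NthRoot.rebase_hD_of_comp X tf hZ hP _ _ _ NH _ _ _ hF (R N) (R 1) (α (one_dvd_level N)) (D N) (hαover N)
  have hfam := hfam_ofConnectedTemperoidFamily_of_rebase 𝒯 ιX h Q odd_l R K' t c₀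
    (fun N => tf.unitsMap_comp_injective (t N) hc₀ (ht N)) hinvc hinvp α β comm_sCap comm_sCup isIsometry_α degFr_α isIsometry_β
    degFr_β baseFrob_α h44 ψ hpull hii h3 h4b h8 h15a h15
    (fun φ χ g => BiKummerSetting.pullFrac_comp_of_rendering X tf hZ hP _ _ _ NH _ _ _ hF φ χ g) D hD T hT
    (fun α₁ β₁ u₁ hu₁ hnum hden =>
      BiKummerSetting.FractionPair.hf_of_normalisedAnchor X tf hZ hP _ _ _ NH _ _ _ hF h44 ψ hii (R 1).pair u₁ hu₁ rfl α₁ β₁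
        hnum hden)
    hArises hebs
    (fun u₁ hu₁ N => by
      obtain ⟨ut, hut, hover, hfix⟩ := hroot₁N u₁ hu₁ N
      -- the level-`N` root rebased over the level-1 pair (abc-iut-f-121's `NthRoot.rebase`, p443132)
      let Rt := (R N).rebase (R 1) (α (one_dvd_level N)) (β (one_dvd_level N)) (comm_sCap (one_dvd_level N))
        (comm_sCup (one_dvd_level N)) (isIsometry_α (one_dvd_level N)) (isIsometry_β (one_dvd_level N))
        (hdeg (degFr_α (one_dvd_level N))) (hdeg (degFr_β (one_dvd_level N))) (D N) (hD N)
      have hpow := BiKummerSetting.pow_twistRoot_eq_pullFrac_of_rendering X tf hZ hP _ _ _ NH _ _ _ hF Rt u₁ hu₁ ut hut hover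
      exact ⟨ut, hut, hover, hpow, BiKummerSetting.isSaturated_twist_of_fixed Rt hpow hfix⟩)
    hivP'
  subst hT
  obtain ⟨αs, βs, -, hdivcap₁, hdivcup₁⟩ :=
    ThetaFrobenioid.exists_seeds_hdivcapcup_ofConnectedTemperoidData_of_isTopCharacteristic (T := 𝒯.level ⟨1, 𝒯.one_mem⟩) h Q
      odd_l (R 1) ιX K' ((Units.map (tf.ratFnFunctor.map (t 1).op).hom).comp c₀) (tf.unitsMap_comp_injective (t 1) hc₀ (ht 1))
      (hinvc 1) (hinvp 1) h44 hnd h3 hcharN hdivA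
  exact thetaRootPreservedAll_ofConnectedTemperoidYddFamily_ofAnchored_genuine_of_constantsDictionary 𝒯 ιX h Q odd_l R K' hX₀ t
    c₀ hc₀ ht hinvc hinvp α β comm_sCap comm_sCup isIsometry_α degFr_α isIsometry_β degFr_β baseFrob_α Cu hC hS _ rfl hnd act₁
    hD₁ hY₁ h44.Ψ cnst G ecn hP34 hYdd αs βs hdivcap₁ hdivcup₁ hP24 hfam hc

end Dictionary

end ThetaFrobenioidTower

end Literature.AnabelianGeometry.EtaleTheta

end
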